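import Summits.Langlands.Langlands.Theorems.SqrtFiveQuarticCoversGroupCensusFiveLemmas

/-!
# `H8 ∩ SL₂(𝔽₅) = C_s(5) ∩ SL₂(𝔽₅)` and `H12 ∩ SL₂(𝔽₅) = C_ns(5) ∩ SL₂(𝔽₅)` — the Cartan
# identification behind the cell's models (CENSUS §3.1), kernel-checked

Route `Langlands/SqrtFiveQuarticCovers` (cell `pub/lg-quartmod`, F-L1).  The eight refined curves
`X(u3, v5, w7)`, `v ∈ {H8, H12}`, are computed in the cell through the identification
"`v ∩ SL₂(𝔽₅) = C(5) ∩ SL₂(𝔽₅)` for `(v, C) = (H8, C_s(5))`, `(H12, C_ns(5))`, hence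
`X(u3,v,w7) ×_k ℂ ≅ X(u3, C(5), w7)(ℂ)`: the refined curves are `k`-forms (quadratic twists through
the Cartan deck involution) of CARTAN-level curves" (CENSUS.md §3.1–3.2; reproduced on three
computational lineages: lead, ref-1 R1(a), eng-1).  This file is a fourth, kernel-checked lineage
for the finite-group half of that statement, as exact descriptions of the two subgroups of the route
statement (`H8 = ⟨diag(2,3), antidiag(1,1)⟩`, `H12 = ⟨(3 1;3 3), diag(1,4)⟩ ≤ GL₂(𝔽₅)`):

* `mem_H8_iff` — `g ∈ H8 ↔ (g diagonal ∧ det g = 1) ∨ (g antidiagonal ∧ det g = -1)`; in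
  particular `H8 ∩ SL₂ = {diag(a, a⁻¹)} = C_s(5) ∩ SL₂` (`mem_H8_iff_of_det_eq_one`) and
  `det H8 ⊆ {±1}`;
* `mem_H12_iff` — `g ∈ H12 ↔ (g a g⁻¹ = a ∧ det g = 1) ∨ (g a g⁻¹ = a⁻¹ ∧ det g = -1)` with
  `a = (3 1;3 3)` (so `𝔽₅[a] ≅ 𝔽₂₅`, `C_ns(5) = 𝔽₅[a]ˣ`); in particular
  `H12 ∩ SL₂ = 𝔽₅[a]ˣ ∩ SL₂ = C_ns(5) ∩ SL₂` (`mem_H12_iff_of_det_eq_one`) and `det H12 ⊆ {±1}`.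

Method: the right-hand sides are shown to be subgroups containing the generators (closure
minimality), and conversely every element of the right-hand side is an explicit word
(`mem_H8_of_shape`, `mem_H12_of_shape` of `…GroupCensusFiveLemmas`).  Route-independent module
(imports only the Lemmas file); no definitions; standard axioms.  Nothing here is a statement about
modular curves — the moduli / twisting half of §3.1–3.2 has no carrier in the tree.
-/

set_option linter.dupNamespace false -- project-wide option (lakefile weak.linter.dupNamespace); `Summit.Langlands.Langlands` is the mandated namespace

namespace Summit.Langlands.Langlands.Theorems.GroupCensusFive

open Matrix

/-- **`H8` exactly.** `g ∈ H8 = ⟨diag(2,3), antidiag(1,1)⟩` iff `g` is diagonal of determinant `1`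
or antidiagonal of determinant `-1`. [folklore] -/
theorem mem_H8_iff (g : GL (Fin 2) (ZMod 5)) :
    g ∈ Subgroup.closure ({(⟨!![2, 0; 0, 3], !![3, 0; 0, 2], by decide, by decide⟩ : GL (Fin 2) (ZMod 5)),
      (⟨!![0, 1; 1, 0], !![0, 1; 1, 0], by decide, by decide⟩ : GL (Fin 2) (ZMod 5))} :
        Set (GL (Fin 2) (ZMod 5))) ↔
    (((g : Matrix (Fin 2) (Fin 2) (ZMod 5)) 0 1 = 0 ∧ (g : Matrix (Fin 2) (Fin 2) (ZMod 5)) 1 0 = 0 ∧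
        Matrix.det (g : Matrix (Fin 2) (Fin 2) (ZMod 5)) = 1) ∨
      ((g : Matrix (Fin 2) (Fin 2) (ZMod 5)) 0 0 = 0 ∧ (g : Matrix (Fin 2) (Fin 2) (ZMod 5)) 1 1 = 0 ∧
        Matrix.det (g : Matrix (Fin 2) (Fin 2) (ZMod 5)) = -1)) := by
  refine ⟨fun hg => ?_, mem_H8_of_shape g⟩
  -- the right-hand side is closed under multiplication …
  have hmul : ∀ u v : GL (Fin 2) (ZMod 5),
      ((((u : Matrix (Fin 2) (Fin 2) (ZMod 5)) 0 1 = 0 ∧ (u : Matrix (Fin 2) (Fin 2) (ZMod 5)) 1 0 = 0 ∧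
          Matrix.det (u : Matrix (Fin 2) (Fin 2) (ZMod 5)) = 1) ∨
        ((u : Matrix (Fin 2) (Fin 2) (ZMod 5)) 0 0 = 0 ∧ (u : Matrix (Fin 2) (Fin 2) (ZMod 5)) 1 1 = 0 ∧
          Matrix.det (u : Matrix (Fin 2) (Fin 2) (ZMod 5)) = -1))) →
      ((((v : Matrix (Fin 2) (Fin 2) (ZMod 5)) 0 1 = 0 ∧ (v : Matrix (Fin 2) (Fin 2) (ZMod 5)) 1 0 = 0 ∧
          Matrix.det (v : Matrix (Fin 2) (Fin 2) (ZMod 5)) = 1) ∨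
        ((v : Matrix (Fin 2) (Fin 2) (ZMod 5)) 0 0 = 0 ∧ (v : Matrix (Fin 2) (Fin 2) (ZMod 5)) 1 1 = 0 ∧
          Matrix.det (v : Matrix (Fin 2) (Fin 2) (ZMod 5)) = -1))) →
      ((((u * v : GL (Fin 2) (ZMod 5)) : Matrix (Fin 2) (Fin 2) (ZMod 5)) 0 1 = 0 ∧
          ((u * v : GL (Fin 2) (ZMod 5)) : Matrix (Fin 2) (Fin 2) (ZMod 5)) 1 0 = 0 ∧
          Matrix.det ((u * v : GL (Fin 2) (ZMod 5)) : Matrix (Fin 2) (Fin 2) (ZMod 5)) = 1) ∨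
        (((u * v : GL (Fin 2) (ZMod 5)) : Matrix (Fin 2) (Fin 2) (ZMod 5)) 0 0 = 0 ∧
          ((u * v : GL (Fin 2) (ZMod 5)) : Matrix (Fin 2) (Fin 2) (ZMod 5)) 1 1 = 0 ∧
          Matrix.det ((u * v : GL (Fin 2) (ZMod 5)) : Matrix (Fin 2) (Fin 2) (ZMod 5)) = -1)) := by
    intro u v hu hv
    obtain ⟨p, q, r, s, hu'⟩ := exists_eq_fin_two (u : Matrix (Fin 2) (Fin 2) (ZMod 5))
    obtain ⟨p', q', r', s', hv'⟩ := exists_eq_fin_two (v : Matrix (Fin 2) (Fin 2) (ZMod 5))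
    rw [Units.val_mul, hu', hv', Matrix.mul_fin_two, Matrix.det_fin_two_of]
    rw [hu', Matrix.det_fin_two_of] at hu
    rw [hv', Matrix.det_fin_two_of] at hv
    simp only [Matrix.of_apply, Matrix.cons_val', Matrix.cons_val_zero, Matrix.cons_val_one,
      Matrix.cons_val_fin_one, Matrix.empty_val'] at hu hv ⊢
    rcases hu with ⟨rfl, rfl, hu⟩ | ⟨rfl, rfl, hu⟩ <;> rcases hv with ⟨rfl, rfl, hv⟩ | ⟨rfl, rfl, hv⟩
    · left; refine ⟨by ring, by ring, ?_⟩; linear_combination s' * p' * hu + hv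
    · right; refine ⟨by ring, by ring, ?_⟩; linear_combination (-(r' * q')) * hu + hv
    · right; refine ⟨by ring, by ring, ?_⟩; linear_combination (p' * s') * hu - hv
    · left; refine ⟨by ring, by ring, ?_⟩; linear_combination (-(q' * r')) * hu - hv
  -- … and every element of it has order dividing `4`, so it is closed under inverses
  have hinv : ∀ u : GL (Fin 2) (ZMod 5),
      ((((u : Matrix (Fin 2) (Fin 2) (ZMod 5)) 0 1 = 0 ∧ (u : Matrix (Fin 2) (Fin 2) (ZMod 5)) 1 0 = 0 ∧
          Matrix.det (u : Matrix (Fin 2) (Fin 2) (ZMod 5)) = 1) ∨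
        ((u : Matrix (Fin 2) (Fin 2) (ZMod 5)) 0 0 = 0 ∧ (u : Matrix (Fin 2) (Fin 2) (ZMod 5)) 1 1 = 0 ∧
          Matrix.det (u : Matrix (Fin 2) (Fin 2) (ZMod 5)) = -1))) → u⁻¹ = u * u * u := by
    intro u hu
    refine inv_eq_of_mul_eq_one_right (Units.ext ?_)
    obtain ⟨p, q, r, s, hu'⟩ := exists_eq_fin_two (u : Matrix (Fin 2) (Fin 2) (ZMod 5))
    rw [hu', Matrix.det_fin_two_of] at hu
    simp only [Matrix.of_apply, Matrix.cons_val', Matrix.cons_val_zero, Matrix.cons_val_one,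
      Matrix.cons_val_fin_one, Matrix.empty_val'] at hu
    rw [Units.val_mul, Units.val_mul, Units.val_mul, Units.val_one, hu', Matrix.mul_fin_two,
      Matrix.mul_fin_two, Matrix.mul_fin_two, Matrix.one_fin_two]
    clear hu'
    rcases hu with ⟨rfl, rfl, hu⟩ | ⟨rfl, rfl, hu⟩
    · revert p s hu; decide
    · revert q r hu; decide
  let K : Subgroup (GL (Fin 2) (ZMod 5)) :=
    { carrier := {u | ((u : Matrix (Fin 2) (Fin 2) (ZMod 5)) 0 1 = 0 ∧ (u : Matrix (Fin 2) (Fin 2) (ZMod 5)) 1 0 = 0 ∧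
          Matrix.det (u : Matrix (Fin 2) (Fin 2) (ZMod 5)) = 1) ∨
        ((u : Matrix (Fin 2) (Fin 2) (ZMod 5)) 0 0 = 0 ∧ (u : Matrix (Fin 2) (Fin 2) (ZMod 5)) 1 1 = 0 ∧
          Matrix.det (u : Matrix (Fin 2) (Fin 2) (ZMod 5)) = -1)}
      mul_mem' := fun {u} {v} hu hv => hmul u v hu hv
      one_mem' := Or.inl ⟨by simp, by simp, by simp⟩
      inv_mem' := fun {u} hu => by
        rw [Set.mem_setOf_eq] at hu ⊢
        rw [hinv u hu]
        exact hmul _ _ (hmul _ _ hu hu) hu }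
  have hle : Subgroup.closure ({(⟨!![2, 0; 0, 3], !![3, 0; 0, 2], by decide, by decide⟩ : GL (Fin 2) (ZMod 5)),
      (⟨!![0, 1; 1, 0], !![0, 1; 1, 0], by decide, by decide⟩ : GL (Fin 2) (ZMod 5))} :
        Set (GL (Fin 2) (ZMod 5))) ≤ K := by
    rw [Subgroup.closure_le]
    intro x hx
    simp only [Set.mem_insert_iff, Set.mem_singleton_iff] at hx
    rcases hx with rfl | rfl
    · change _ ∨ _
      left
      refine ⟨rfl, rfl, ?_⟩
      rw [Matrix.det_fin_two_of]; decide
    · change _ ∨ _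
      right
      refine ⟨rfl, rfl, ?_⟩
      rw [Matrix.det_fin_two_of]; decide
  exact hle hg

/-- **`H8 ∩ SL₂(𝔽₅) = C_s(5) ∩ SL₂(𝔽₅)`** (CENSUS §3.1 for `v = H8`): an element of determinant `1`
lies in `H8` iff it is diagonal. [folklore] -/
theorem mem_H8_iff_of_det_eq_one (g : GL (Fin 2) (ZMod 5))
    (hd : Matrix.det (g : Matrix (Fin 2) (Fin 2) (ZMod 5)) = 1) :
    g ∈ Subgroup.closure ({(⟨!![2, 0; 0, 3], !![3, 0; 0, 2], by decide, by decide⟩ : GL (Fin 2) (ZMod 5)),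
      (⟨!![0, 1; 1, 0], !![0, 1; 1, 0], by decide, by decide⟩ : GL (Fin 2) (ZMod 5))} :
        Set (GL (Fin 2) (ZMod 5))) ↔
    ((g : Matrix (Fin 2) (Fin 2) (ZMod 5)) 0 1 = 0 ∧ (g : Matrix (Fin 2) (Fin 2) (ZMod 5)) 1 0 = 0) := by
  rw [mem_H8_iff]
  constructor
  · rintro (⟨h1, h2, -⟩ | ⟨-, -, h3⟩)
    · exact ⟨h1, h2⟩
    · rw [hd] at h3; exact absurd h3 (by decide)
  · exact fun ⟨h1, h2⟩ => Or.inl ⟨h1, h2, hd⟩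


/-- **`H12` exactly.** `g ∈ H12 = ⟨a, f⟩`, `a = (3 1;3 3)` (of order `6`, `𝔽₅[a] ≅ 𝔽₂₅`),
`f = diag(1,4)`, iff `g` commutes with `a` and `det g = 1`, or `g a g⁻¹ = a⁻¹ = (3 4;2 3)` and
`det g = -1`: `H12 = C₆ ⋊ ⟨f⟩` with `C₆ = 𝔽₅[a]ˣ ∩ SL₂(𝔽₅)` the norm-one group of `𝔽₂₅` and `f` acting
as the Frobenius. [folklore] -/
theorem mem_H12_iff (g : GL (Fin 2) (ZMod 5)) :
    g ∈ Subgroup.closure ({(⟨!![3, 1; 3, 3], !![3, 4; 2, 3], by decide, by decide⟩ : GL (Fin 2) (ZMod 5)),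
      (⟨!![1, 0; 0, 4], !![1, 0; 0, 4], by decide, by decide⟩ : GL (Fin 2) (ZMod 5))} : Set (GL (Fin 2) (ZMod 5))) ↔
    ((((g : GL (Fin 2) (ZMod 5)) : Matrix (Fin 2) (Fin 2) (ZMod 5)) * (!![3, 1; 3, 3] : Matrix (Fin 2) (Fin 2) (ZMod 5)) = (!![3, 1; 3, 3] : Matrix (Fin 2) (Fin 2) (ZMod 5)) * ((g : GL (Fin 2) (ZMod 5)) : Matrix (Fin 2) (Fin 2) (ZMod 5)) ∧ Matrix.det ((g : GL (Fin 2) (ZMod 5)) : Matrix (Fin 2) (Fin 2) (ZMod 5)) = 1) ∨ (((g : GL (Fin 2) (ZMod 5)) : Matrix (Fin 2) (Fin 2) (ZMod 5)) * (!![3, 1; 3, 3] : Matrix (Fin 2) (Fin 2) (ZMod 5)) = (!![3, 4; 2, 3] : Matrix (Fin 2) (Fin 2) (ZMod 5)) * ((g : GL (Fin 2) (ZMod 5)) : Matrix (Fin 2) (Fin 2) (ZMod 5)) ∧ Matrix.det ((g : GL (Fin 2) (ZMod 5)) : Matrix (Fin 2) (Fin 2) (ZMod 5)) = -1)) := by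
  have hAA' : (!![3, 1; 3, 3] : Matrix (Fin 2) (Fin 2) (ZMod 5)) * (!![3, 4; 2, 3] : Matrix (Fin 2) (Fin 2) (ZMod 5)) = 1 := by decide
  have hA'A : (!![3, 4; 2, 3] : Matrix (Fin 2) (Fin 2) (ZMod 5)) * (!![3, 1; 3, 3] : Matrix (Fin 2) (Fin 2) (ZMod 5)) = 1 := by decide
  have hFA : (!![1, 0; 0, 4] : Matrix (Fin 2) (Fin 2) (ZMod 5)) * !![3, 1; 3, 3] = (!![3, 4; 2, 3] : Matrix (Fin 2) (Fin 2) (ZMod 5)) * !![1, 0; 0, 4] := by decide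
  -- from `U a = a U`: `U a⁻¹ = a⁻¹ U`; from `U a = a⁻¹ U`: `U a⁻¹ = a U`
  have key1 : ∀ U : Matrix (Fin 2) (Fin 2) (ZMod 5), U * (!![3, 1; 3, 3] : Matrix (Fin 2) (Fin 2) (ZMod 5)) = (!![3, 1; 3, 3] : Matrix (Fin 2) (Fin 2) (ZMod 5)) * U → U * (!![3, 4; 2, 3] : Matrix (Fin 2) (Fin 2) (ZMod 5)) = (!![3, 4; 2, 3] : Matrix (Fin 2) (Fin 2) (ZMod 5)) * U := fun U hU =>
    calc U * (!![3, 4; 2, 3] : Matrix (Fin 2) (Fin 2) (ZMod 5)) = (!![3, 4; 2, 3] : Matrix (Fin 2) (Fin 2) (ZMod 5)) * (!![3, 1; 3, 3] : Matrix (Fin 2) (Fin 2) (ZMod 5)) * U * (!![3, 4; 2, 3] : Matrix (Fin 2) (Fin 2) (ZMod 5)) := by rw [hA'A, Matrix.one_mul]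
      _ = (!![3, 4; 2, 3] : Matrix (Fin 2) (Fin 2) (ZMod 5)) * (U * (!![3, 1; 3, 3] : Matrix (Fin 2) (Fin 2) (ZMod 5))) * (!![3, 4; 2, 3] : Matrix (Fin 2) (Fin 2) (ZMod 5)) := by rw [Matrix.mul_assoc (!![3, 4; 2, 3] : Matrix (Fin 2) (Fin 2) (ZMod 5)) (!![3, 1; 3, 3] : Matrix (Fin 2) (Fin 2) (ZMod 5)) U, ← hU]
      _ = (!![3, 4; 2, 3] : Matrix (Fin 2) (Fin 2) (ZMod 5)) * U := by rw [Matrix.mul_assoc, Matrix.mul_assoc, hAA', Matrix.mul_one]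
  have key2 : ∀ U : Matrix (Fin 2) (Fin 2) (ZMod 5), U * (!![3, 1; 3, 3] : Matrix (Fin 2) (Fin 2) (ZMod 5)) = (!![3, 4; 2, 3] : Matrix (Fin 2) (Fin 2) (ZMod 5)) * U → U * (!![3, 4; 2, 3] : Matrix (Fin 2) (Fin 2) (ZMod 5)) = (!![3, 1; 3, 3] : Matrix (Fin 2) (Fin 2) (ZMod 5)) * U := fun U hU =>
    calc U * (!![3, 4; 2, 3] : Matrix (Fin 2) (Fin 2) (ZMod 5)) = (!![3, 1; 3, 3] : Matrix (Fin 2) (Fin 2) (ZMod 5)) * (!![3, 4; 2, 3] : Matrix (Fin 2) (Fin 2) (ZMod 5)) * U * (!![3, 4; 2, 3] : Matrix (Fin 2) (Fin 2) (ZMod 5)) := by rw [hAA', Matrix.one_mul]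
      _ = (!![3, 1; 3, 3] : Matrix (Fin 2) (Fin 2) (ZMod 5)) * (U * (!![3, 1; 3, 3] : Matrix (Fin 2) (Fin 2) (ZMod 5))) * (!![3, 4; 2, 3] : Matrix (Fin 2) (Fin 2) (ZMod 5)) := by rw [Matrix.mul_assoc (!![3, 1; 3, 3] : Matrix (Fin 2) (Fin 2) (ZMod 5)) (!![3, 4; 2, 3] : Matrix (Fin 2) (Fin 2) (ZMod 5)) U, ← hU]
      _ = (!![3, 1; 3, 3] : Matrix (Fin 2) (Fin 2) (ZMod 5)) * U := by rw [Matrix.mul_assoc, Matrix.mul_assoc, hAA', Matrix.mul_one]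
  constructor
  · intro hg
    have hmul : ∀ u v : GL (Fin 2) (ZMod 5), ((((u : GL (Fin 2) (ZMod 5)) : Matrix (Fin 2) (Fin 2) (ZMod 5)) * (!![3, 1; 3, 3] : Matrix (Fin 2) (Fin 2) (ZMod 5)) = (!![3, 1; 3, 3] : Matrix (Fin 2) (Fin 2) (ZMod 5)) * ((u : GL (Fin 2) (ZMod 5)) : Matrix (Fin 2) (Fin 2) (ZMod 5)) ∧ Matrix.det ((u : GL (Fin 2) (ZMod 5)) : Matrix (Fin 2) (Fin 2) (ZMod 5)) = 1) ∨ (((u : GL (Fin 2) (ZMod 5)) : Matrix (Fin 2) (Fin 2) (ZMod 5)) * (!![3, 1; 3, 3] : Matrix (Fin 2) (Fin 2) (ZMod 5)) = (!![3, 4; 2, 3] : Matrix (Fin 2) (Fin 2) (ZMod 5)) * ((u : GL (Fin 2) (ZMod 5)) : Matrix (Fin 2) (Fin 2) (ZMod 5)) ∧ Matrix.det ((u : GL (Fin 2) (ZMod 5)) : Matrix (Fin 2) (Fin 2) (ZMod 5)) = -1)) → ((((v : GL (Fin 2) (ZMod 5)) : Matrix (Fin 2) (Fin 2) (ZMod 5))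 * (!![3, 1; 3, 3] : Matrix (Fin 2) (Fin 2) (ZMod 5)) = (!![3, 1; 3, 3] : Matrix (Fin 2) (Fin 2) (ZMod 5)) * ((v : GL (Fin 2) (ZMod 5)) : Matrix (Fin 2) (Fin 2) (ZMod 5)) ∧ Matrix.det ((v : GL (Fin 2) (ZMod 5)) : Matrix (Fin 2) (Fin 2) (ZMod 5)) = 1) ∨ (((v : GL (Fin 2) (ZMod 5)) : Matrix (Fin 2) (Fin 2) (ZMod 5)) * (!![3, 1; 3, 3] : Matrix (Fin 2) (Fin 2) (ZMod 5)) = (!![3, 4; 2, 3] : Matrix (Fin 2) (Fin 2) (ZMod 5)) * ((v : GL (Fin 2) (ZMod 5)) : Matrix (Fin 2) (Fin 2) (ZMod 5)) ∧ Matrix.det ((v : GL (Fin 2) (ZMod 5)) : Matrix (Fin 2) (Fin 2) (ZMod 5)) = -1)) → ((((u * v : GL (Fin 2) (ZMod 5)) : Matrix (Fin 2) (Fin 2) (ZMod 5)) * (!![3, 1; 3, 3] : Matrix (Fin 2) (Fin 2) (ZMod 5)) = (!![3, 1; 3, 3] : Matrix (Fin 2) (Fin 2) (ZMod 5)) * ((u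 * v : GL (Fin 2) (ZMod 5)) : Matrix (Fin 2) (Fin 2) (ZMod 5)) ∧ Matrix.det ((u * v : GL (Fin 2) (ZMod 5)) : Matrix (Fin 2) (Fin 2) (ZMod 5)) = 1) ∨ (((u * v : GL (Fin 2) (ZMod 5)) : Matrix (Fin 2) (Fin 2) (ZMod 5)) * (!![3, 1; 3, 3] : Matrix (Fin 2) (Fin 2) (ZMod 5)) = (!![3, 4; 2, 3] : Matrix (Fin 2) (Fin 2) (ZMod 5)) * ((u * v : GL (Fin 2) (ZMod 5)) : Matrix (Fin 2) (Fin 2) (ZMod 5)) ∧ Matrix.det ((u * v : GL (Fin 2) (ZMod 5)) : Matrix (Fin 2) (Fin 2) (ZMod 5)) = -1)) := by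
      intro u v hu hv
      rw [Units.val_mul, Matrix.det_mul]
      rcases hu with ⟨hu, du⟩ | ⟨hu, du⟩ <;> rcases hv with ⟨hv, dv⟩ | ⟨hv, dv⟩
      · left; refine ⟨?_, by rw [du, dv, one_mul]⟩
        rw [Matrix.mul_assoc, hv, ← Matrix.mul_assoc, hu, Matrix.mul_assoc]
      · right; refine ⟨?_, by rw [du, dv, one_mul]⟩
        rw [Matrix.mul_assoc, hv, ← Matrix.mul_assoc, key1 _ hu, Matrix.mul_assoc]
      · right; refine ⟨?_, by rw [du, dv, mul_one]⟩
        rw [Matrix.mul_assoc, hv, ← Matrix.mul_assoc, hu, Matrix.mul_assoc]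
      · left; refine ⟨?_, by rw [du, dv]; norm_num⟩
        rw [Matrix.mul_assoc, hv, ← Matrix.mul_assoc, key2 _ hu, Matrix.mul_assoc]
    have hinv : ∀ u : GL (Fin 2) (ZMod 5), ((((u : GL (Fin 2) (ZMod 5)) : Matrix (Fin 2) (Fin 2) (ZMod 5)) * (!![3, 1; 3, 3] : Matrix (Fin 2) (Fin 2) (ZMod 5)) = (!![3, 1; 3, 3] : Matrix (Fin 2) (Fin 2) (ZMod 5)) * ((u : GL (Fin 2) (ZMod 5)) : Matrix (Fin 2) (Fin 2) (ZMod 5)) ∧ Matrix.det ((u : GL (Fin 2) (ZMod 5)) : Matrix (Fin 2) (Fin 2) (ZMod 5)) = 1) ∨ (((u : GL (Fin 2) (ZMod 5)) : Matrix (Fin 2) (Fin 2) (ZMod 5)) * (!![3, 1; 3, 3] : Matrix (Fin 2) (Fin 2) (ZMod 5)) = (!![3, 4; 2, 3] : Matrix (Fin 2) (Fin 2) (ZMod 5)) * ((u : GL (Fin 2) (ZMod 5)) : Matrix (Fin 2) (Fin 2) (ZMod 5)) ∧ Matrix.det ((u : GL (Fin 2) (ZMod 5)) : Matrix (Fin 2)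 (Fin 2) (ZMod 5)) = -1)) → ((((u⁻¹ : GL (Fin 2) (ZMod 5)) : Matrix (Fin 2) (Fin 2) (ZMod 5)) * (!![3, 1; 3, 3] : Matrix (Fin 2) (Fin 2) (ZMod 5)) = (!![3, 1; 3, 3] : Matrix (Fin 2) (Fin 2) (ZMod 5)) * ((u⁻¹ : GL (Fin 2) (ZMod 5)) : Matrix (Fin 2) (Fin 2) (ZMod 5)) ∧ Matrix.det ((u⁻¹ : GL (Fin 2) (ZMod 5)) : Matrix (Fin 2) (Fin 2) (ZMod 5)) = 1) ∨ (((u⁻¹ : GL (Fin 2) (ZMod 5)) : Matrix (Fin 2) (Fin 2) (ZMod 5)) * (!![3, 1; 3, 3] : Matrix (Fin 2) (Fin 2) (ZMod 5)) = (!![3, 4; 2, 3] : Matrix (Fin 2) (Fin 2) (ZMod 5)) * ((u⁻¹ : GL (Fin 2) (ZMod 5)) : Matrix (Fin 2) (Fin 2) (ZMod 5)) ∧ Matrix.det ((u⁻¹ : GL (Fin 2) (ZMod 5)) : Matrix (Fin 2) (Fin 2) (ZMod 5)) = -1)) := by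
      intro u hu
      have hdet : Matrix.det ((u⁻¹ : GL (Fin 2) (ZMod 5)) : Matrix (Fin 2) (Fin 2) (ZMod 5)) * Matrix.det ((u : GL (Fin 2) (ZMod 5)) : Matrix (Fin 2) (Fin 2) (ZMod 5)) = 1 := by
        rw [← Matrix.det_mul, ← Units.val_mul, inv_mul_cancel, Units.val_one, Matrix.det_one]
      have conj : ∀ B : Matrix (Fin 2) (Fin 2) (ZMod 5), ((u : GL (Fin 2) (ZMod 5)) : Matrix (Fin 2) (Fin 2) (ZMod 5)) * (!![3, 1; 3, 3] : Matrix (Fin 2) (Fin 2) (ZMod 5)) = B * ((u : GL (Fin 2) (ZMod 5)) : Matrix (Fin 2) (Fin 2) (ZMod 5)) →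
          ((u⁻¹ : GL (Fin 2) (ZMod 5)) : Matrix (Fin 2) (Fin 2) (ZMod 5)) * B = (!![3, 1; 3, 3] : Matrix (Fin 2) (Fin 2) (ZMod 5)) * ((u⁻¹ : GL (Fin 2) (ZMod 5)) : Matrix (Fin 2) (Fin 2) (ZMod 5)) := fun B hB =>
        calc ((u⁻¹ : GL (Fin 2) (ZMod 5)) : Matrix (Fin 2) (Fin 2) (ZMod 5)) * B
            = ((u⁻¹ : GL (Fin 2) (ZMod 5)) : Matrix (Fin 2) (Fin 2) (ZMod 5)) * B * (((u : GL (Fin 2) (ZMod 5)) : Matrix (Fin 2) (Fin 2) (ZMod 5)) * ((u⁻¹ : GL (Fin 2) (ZMod 5)) : Matrix (Fin 2) (Fin 2) (ZMod 5))) := by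
              rw [← Units.val_mul, mul_inv_cancel, Units.val_one, Matrix.mul_one]
          _ = ((u⁻¹ : GL (Fin 2) (ZMod 5)) : Matrix (Fin 2) (Fin 2) (ZMod 5)) * (((u : GL (Fin 2) (ZMod 5)) : Matrix (Fin 2) (Fin 2) (ZMod 5)) * (!![3, 1; 3, 3] : Matrix (Fin 2) (Fin 2) (ZMod 5))) * ((u⁻¹ : GL (Fin 2) (ZMod 5)) : Matrix (Fin 2) (Fin 2) (ZMod 5)) := by
              rw [hB]; simp only [Matrix.mul_assoc]
          _ = (!![3, 1; 3, 3] : Matrix (Fin 2) (Fin 2) (ZMod 5)) * ((u⁻¹ : GL (Fin 2) (ZMod 5)) : Matrix (Fin 2) (Fin 2) (ZMod 5)) := by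
              rw [← Matrix.mul_assoc, ← Units.val_mul, inv_mul_cancel, Units.val_one, Matrix.one_mul]
      rcases hu with ⟨hu, du⟩ | ⟨hu, du⟩
      · left
        refine ⟨conj _ hu, ?_⟩
        rw [du, mul_one] at hdet; exact hdet
      · right
        refine ⟨?_, ?_⟩
        · -- `u⁻¹ a = a⁻¹ u⁻¹` from `u a⁻¹ = a u`
          have h2 := key2 _ hu
          calc ((u⁻¹ : GL (Fin 2) (ZMod 5)) : Matrix (Fin 2) (Fin 2) (ZMod 5)) * (!![3, 1; 3, 3] : Matrix (Fin 2) (Fin 2) (ZMod 5))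
              = ((u⁻¹ : GL (Fin 2) (ZMod 5)) : Matrix (Fin 2) (Fin 2) (ZMod 5)) * (!![3, 1; 3, 3] : Matrix (Fin 2) (Fin 2) (ZMod 5)) * (((u : GL (Fin 2) (ZMod 5)) : Matrix (Fin 2) (Fin 2) (ZMod 5)) * ((u⁻¹ : GL (Fin 2) (ZMod 5)) : Matrix (Fin 2) (Fin 2) (ZMod 5))) := by
                rw [← Units.val_mul, mul_inv_cancel, Units.val_one, Matrix.mul_one]
            _ = ((u⁻¹ : GL (Fin 2) (ZMod 5)) : Matrix (Fin 2) (Fin 2) (ZMod 5)) * (((u : GL (Fin 2) (ZMod 5)) : Matrix (Fin 2) (Fin 2) (ZMod 5)) * (!![3, 4; 2, 3] : Matrix (Fin 2) (Fin 2) (ZMod 5))) * ((u⁻¹ : GL (Fin 2) (ZMod 5)) : Matrix (Fin 2) (Fin 2) (ZMod 5)) := by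
                rw [h2]; simp only [Matrix.mul_assoc]
            _ = (!![3, 4; 2, 3] : Matrix (Fin 2) (Fin 2) (ZMod 5)) * ((u⁻¹ : GL (Fin 2) (ZMod 5)) : Matrix (Fin 2) (Fin 2) (ZMod 5)) := by
                rw [← Matrix.mul_assoc, ← Units.val_mul, inv_mul_cancel, Units.val_one, Matrix.one_mul]
        · rw [du] at hdet; linear_combination -hdet
    let K : Subgroup (GL (Fin 2) (ZMod 5)) :=
      { carrier := {u | ((((u : GL (Fin 2) (ZMod 5)) : Matrix (Fin 2) (Fin 2) (ZMod 5)) * (!![3, 1; 3, 3] : Matrix (Fin 2) (Fin 2) (ZMod 5)) = (!![3, 1; 3, 3] : Matrix (Fin 2) (Fin 2) (ZMod 5)) * ((u : GL (Fin 2) (ZMod 5)) : Matrix (Fin 2) (Fin 2) (ZMod 5)) ∧ Matrix.det ((u : GL (Fin 2) (ZMod 5)) : Matrix (Fin 2) (Fin 2) (ZMod 5)) = 1) ∨ (((u : GL (Fin 2) (ZMod 5)) : Matrix (Fin 2) (Fin 2) (ZMod 5)) * (!![3, 1; 3, 3] : Matrix (Fin 2) (Fin 2) (ZMod 5)) = (!![3,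 4; 2, 3] : Matrix (Fin 2) (Fin 2) (ZMod 5)) * ((u : GL (Fin 2) (ZMod 5)) : Matrix (Fin 2) (Fin 2) (ZMod 5)) ∧ Matrix.det ((u : GL (Fin 2) (ZMod 5)) : Matrix (Fin 2) (Fin 2) (ZMod 5)) = -1))}
        mul_mem' := fun {u} {v} hu hv => hmul u v hu hv
        one_mem' := Or.inl ⟨by rw [Units.val_one, Matrix.one_mul, Matrix.mul_one], by simp⟩
        inv_mem' := fun {u} hu => hinv u hu }
    have hle : Subgroup.closure ({(⟨!![3, 1; 3, 3], !![3, 4; 2, 3], by decide, by decide⟩ : GL (Fin 2) (ZMod 5)),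
      (⟨!![1, 0; 0, 4], !![1, 0; 0, 4], by decide, by decide⟩ : GL (Fin 2) (ZMod 5))} : Set (GL (Fin 2) (ZMod 5))) ≤ K := by
      rw [Subgroup.closure_le]
      intro x hx
      simp only [Set.mem_insert_iff, Set.mem_singleton_iff] at hx
      rcases hx with rfl | rfl
      · change _ ∨ _
        left
        exact ⟨rfl, by rw [Matrix.det_fin_two_of]; decide⟩
      · change _ ∨ _
        right
        exact ⟨by decide, by rw [Matrix.det_fin_two_of]; decide⟩
    exact hle hg
  · intro h
    apply mem_H12_of_shape
    rcases h with ⟨h, d⟩ | ⟨h, d⟩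
    · exact Or.inl ⟨h, d⟩
    · refine Or.inr ⟨?_, d⟩
      rw [Matrix.mul_assoc, hFA, ← Matrix.mul_assoc, key2 _ h, Matrix.mul_assoc]

/-- **`H12 ∩ SL₂(𝔽₅) = C_ns(5) ∩ SL₂(𝔽₅)`** (CENSUS §3.1 for `v = H12`): an element of determinant
`1` lies in `H12` iff it commutes with `a = (3 1;3 3)`, i.e. lies in the non-split Cartan subgroup
`𝔽₅[a]ˣ ≅ 𝔽₂₅ˣ`. [folklore] -/
theorem mem_H12_iff_of_det_eq_one (g : GL (Fin 2) (ZMod 5))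
    (hd : Matrix.det (g : Matrix (Fin 2) (Fin 2) (ZMod 5)) = 1) :
    g ∈ Subgroup.closure ({(⟨!![3, 1; 3, 3], !![3, 4; 2, 3], by decide, by decide⟩ : GL (Fin 2) (ZMod 5)),
      (⟨!![1, 0; 0, 4], !![1, 0; 0, 4], by decide, by decide⟩ : GL (Fin 2) (ZMod 5))} : Set (GL (Fin 2) (ZMod 5))) ↔
    (g : Matrix (Fin 2) (Fin 2) (ZMod 5)) * !![3, 1; 3, 3] = !![3, 1; 3, 3] * (g : Matrix (Fin 2) (Fin 2) (ZMod 5)) := by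
  rw [mem_H12_iff]
  constructor
  · rintro (⟨h1, -⟩ | ⟨-, h3⟩)
    · exact h1
    · rw [hd] at h3; exact absurd h3 (by decide)
  · exact fun h1 => Or.inl ⟨h1, hd⟩

end Summit.Langlands.Langlands.Theorems.GroupCensusFive
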